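import Literature.NumberTheory.EllipticCurves.ComplexMultiplicationTwistIsogenyProofs
import Literature.NumberTheory.EllipticCurves.ComplexMultiplicationHasCMThirteenProofs
import Literature.NumberTheory.EllipticCurves.Rank1Residual.Predicates
import HarnessLib

/-!
# ROUTE U — every model of `49a1^{(D)}` has `j = −3375`, CM, and CM field `ℚ(√−7)`

bsd-cm cell, ROUTE U (Theorem U: BSD(49a1^{(D)}, 7) ⇒ full BSD on `𝒞₇`). The binder dischargers of
`RouteUSevenBinders` (`hns`: `#Ẽ^{ns}(𝔽₇) = 7`, and `h2`: no split multiplicative prime) ask for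
`W.HasCM` and `cmFieldDiscrOfJ W.j = −7`; for a curve `W/ℚ` with `C • W = 49a1^{(D)}` (`D ≠ 0`)
both follow from `j(W) = j(49a1) = −3375` (`j` is invariant under `C` and under quadratic twists,
tree `variableChange_j`, `j_quadraticTwist`, `j_cm7`) and the CM classification (tree
`hasCM_of_j_mem_cmJInvariants`, Silverman App. C §11). THEOREMS ONLY.
-/

noncomputable section

open scoped Classical
open WeierstrassCurve Literature.NumberTheory.EllipticCurves
open Literature.NumberTheory.EllipticCurves.Rank1Residual

namespace Summit.BirchSwinnertonDyer.Rank1Residual.X12.O11.RouteU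

/-- **`j(W) = −3375`** for every `W/ℚ` with `C • W = 49a1^{(D)}`, `D ≠ 0`.
[cite: SilvermanAEC2009, III.1 Prop. 1.4(b) and X.5 Cor. 5.4] [cite: Cremona1997, Table 1 (49a1: j = −3375)] -/
theorem j_of_twist_cm7 (W : WeierstrassCurve ℚ) [W.IsElliptic] {D : ℤ} (hD : D ≠ 0)
    (hW : ∃ C : VariableChange ℚ, C • W = cm7.quadraticTwist (D : ℚ)) : W.j = -3375 := by
  obtain ⟨C, hC⟩ := hW
  have hD' : (D : ℚ) ≠ 0 := by exact_mod_cast hD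
  haveI := cm7.isElliptic_quadraticTwist hD'
  rw [← W.variableChange_j C]
  have h : (C • W).j = (cm7.quadraticTwist (D : ℚ)).j := by
    simp only [hC]
  rw [h, j_quadraticTwist cm7 hD', j_cm7]

/-- **Every model of `49a1^{(D)}` has complex multiplication** (`j = −3375 ∈` the thirteen CM
`j`-invariants). [cite: SilvermanAEC2009, App. C §11, Example 11.3.1] -/
theorem hasCM_of_twist_cm7 (W : WeierstrassCurve ℚ) [W.IsElliptic] {D : ℤ} (hD : D ≠ 0)
    (hW : ∃ C : VariableChange ℚ, C • W = cm7.quadraticTwist (D : ℚ)) : W.HasCM :=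
  hasCM_of_j_mem_cmJInvariants W (by rw [j_of_twist_cm7 W hD hW]; decide)

/-- **The CM field of every model of `49a1^{(D)}` is `ℚ(√−7)`**: `cmFieldDiscrOfJ (j W) = −7`
(so `7` is the ramified CM prime: `CMRamified W 7`). [cite: SilvermanATAEC1994, App. A §3 (table of CM j-invariants)] -/
theorem cmFieldDiscrOfJ_of_twist_cm7 (W : WeierstrassCurve ℚ) [W.IsElliptic] {D : ℤ} (hD : D ≠ 0)
    (hW : ∃ C : VariableChange ℚ, C • W = cm7.quadraticTwist (D : ℚ)) :
    cmFieldDiscrOfJ W.j = -7 := by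
  rw [j_of_twist_cm7 W hD hW]
  norm_num [cmFieldDiscrOfJ]

end Summit.BirchSwinnertonDyer.Rank1Residual.X12.O11.RouteU

end
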